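import Literature.NumberTheory.Transcendental.BakerQuantObstruction
import Literature.NumberTheory.Transcendental.DiazZeroLemmaMult
import Literature.NumberTheory.Transcendental.SixExponentialsSeveralVariablesThm41Proofs
import HarnessLib

/-!
# The linear subgroup theorem on `𝔾ₐ × 𝔾ₘ^N` (Waldschmidt 1988, Thm 4.1), IV: the endgame

Topic `Literature/NumberTheory/Transcendental`; fourth file of the direct proof of
[Waldschmidt1988, Thm 4.1] for `G = 𝔾ₐ × 𝔾ₘ^N` (plan in `LinearSubgroupGaGmAuxiliary.lean`).
This file is "§7" of the source: GIVEN, for all large `S`, a non-zero polynomial of partial degrees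
`≤ D₀ = S^N L`, `≤ D₁ = C₁ S^{N-1} L⁴` (each torus variable; `L = L(S) → ∞` slowly) vanishing to
order `≥ (N+1)T + 1`, `T = S^N L²`, along `exp_G(W)` at the points `σ(μ) = exp_G(∑ μ_k y_k)`,
`0 ≤ μ_k ≤ (N+1)S`, of the group `Y = ∑ ℤ y_k` (`y_k = (θ_k, (z_{hk})_h)`, the points of
`DiazZL.sig`), Philippon's zero estimate with multiplicities (the tree's THEOREM
`Philippon1986_GaGm_holds`) produces an obstructing connected algebraic subgroup `G' = V' × T_M`,
and the comparison of exponents of `S` in its inequality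
`binom(T+τ,τ) · #(Σ/G') · D₀^{dim V'} (ND₁)^{dim T_M} ≤ c D₀ (ND₁)^N` yields the conclusion of
Theorem 4.1 in the form (`d = N + 1`, `n = N`, `d₁ = N`, `d₂ = 0`, periods dropped — `κ = 0`):

  `τ < δ` and `λ + δ₁ ≤ N (δ − τ)`,

`δ₀ = 1 − dim V'`, `δ₁ = N − dim T_M`, `δ = δ₀ + δ₁`, `τ = dim W − dim (W ∩ Lie G')`,
`λ = ℓ − r` where `r` independent integer relations `ρᵢ` with `σ(ρᵢ) ∈ G'` are exhibited
(`#(Σ/G') ≥ (S+1)^{ℓ - rank}` by `Waldschmidt1981.exists_coord_complement`; `G' ≠ G` because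
`P ≠ 0`, `DiazZLM.eq_zero_of_evalAt_translate`). The case `τ = δ` is excluded by `T/D₀ = L → ∞`
("choose `a = 1` and `b > t`", [Waldschmidt1988] p. 390); all other bad cases by one clear power of
`S` against `L^{4N+1}` (`numeric_exclusion`).

Everything here is PROVED; no definitions, no named facts.

## References

* [Waldschmidt1988] M. Waldschmidt, *On the transcendence methods of Gel'fond and Schneider in
  several variables*, New Advances in Transcendence Theory (A. Baker ed.), CUP 1988, 375–398, §4
  Thm 4.1, §7 (7.2)–(7.3) (held scan `book:baker1988-new-advances-transcendence-theory`, pp. 304–305,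
  311–312).
* [Philippon1986] P. Philippon, *Lemmes de zéros dans les groupes algébriques commutatifs*,
  Bull. Soc. Math. France 114 (1986), 355–383, Théorème 2.1.
-/

noncomputable section

open Finset Module Filter

namespace Literature.NumberTheory.Transcendental.LinearSubgroupGaGm

open GaGm DiazZL
open Baker1975.Ch3 (torusDim_le chars_eq_bot_of_torusDim_eq)

/-! ### The comparison of exponents -/

/-- A lower bound for binomial coefficients: `T^τ ≤ τ! · binom(T + τ, τ)`. [folklore] -/
theorem pow_le_factorial_mul_choose (T τ : ℕ) : T ^ τ ≤ τ.factorial * (T + τ).choose τ := by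
  rw [← Nat.ascFactorial_eq_factorial_mul_choose]
  exact (Nat.pow_succ_le_ascFactorial T τ).trans (Nat.ascFactorial_le τ (Nat.le_succ T))

/-- **The comparison of exponents of `S`** ([Waldschmidt1988], end of §7), abstract form. With
`N = n + 1`, parameters `T, D₀ ≥ S^N`, `D₁ ≥ S^n` such that `K D₀ D₁^N < S^{N² + 1}` and
`K D₀ < T` (`K = t! c`): if `T^τ (S+1)^λ D₀^{a'} D₁^{b'} ≤ K D₀ D₁^N` with `a' ≤ 1`, `b' ≤ N`,
`(a', b') ≠ (1, N)`, then `τ < δ` and `λ + δ₁ + Nτ ≤ Nδ` (`δ₁ = N − b'`, `δ = (1 − a') + δ₁`).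
[cite: Waldschmidt1988, §7 (7.3)] -/
theorem numeric_exclusion {n K S T D₀ D₁ τ lam a' b' : ℕ} (hS : 1 ≤ S)
    (hT : S ^ (n + 1) ≤ T) (hD₀ : S ^ (n + 1) ≤ D₀) (hD₁ : S ^ n ≤ D₁)
    (hR : K * D₀ * D₁ ^ (n + 1) < S ^ ((n + 1) * (n + 1) + 1)) (hTD : K * D₀ < T)
    (ha : a' ≤ 1) (hb : b' ≤ n + 1) (hnot : ¬ (a' = 1 ∧ b' = n + 1))
    (hineq : T ^ τ * (S + 1) ^ lam * D₀ ^ a' * D₁ ^ b' ≤ K * D₀ * D₁ ^ (n + 1)) :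
    τ < (1 - a') + (n + 1 - b') ∧
      lam + (n + 1 - b') + (n + 1) * τ ≤ (n + 1) * ((1 - a') + (n + 1 - b')) := by
  -- the exponent of `S` on the left is at most `N²`
  have hLHS : S ^ ((n + 1) * τ + lam + (n + 1) * a' + n * b') ≤
      T ^ τ * (S + 1) ^ lam * D₀ ^ a' * D₁ ^ b' := by
    rw [pow_add, pow_add, pow_add, pow_mul, pow_mul, pow_mul]
    gcongr
    · exact hS.trans (Nat.le_succ S) |> fun _ => Nat.le_succ S
  have heL_le : (n + 1) * τ + lam + (n + 1) * a' + n * b' ≤ (n + 1) * (n + 1) := by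
    by_contra hgt
    push Not at hgt
    have h1 : S ^ ((n + 1) * (n + 1) + 1) ≤ S ^ ((n + 1) * τ + lam + (n + 1) * a' + n * b') :=
      Nat.pow_le_pow_right hS hgt
    exact absurd (hR.trans_le (h1.trans (hLHS.trans hineq))) (lt_irrefl _)
  obtain ⟨d, hd⟩ : ∃ d, b' + d = n + 1 := ⟨n + 1 - b', by omega⟩
  have hd' : n + 1 - b' = d := by omega
  rw [hd']
  have hnb : n * b' + n * d = n * n + n := by rw [← mul_add, hd]; ring
  constructor
  · -- `τ < δ`: otherwise the tuple is `(τ, λ, a', b') = (1, 0, 0, N)` and `T ≤ K D₀`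
    by_contra hτδ
    push Not at hτδ
    have hspecial : a' = 0 ∧ d = 0 ∧ lam = 0 ∧ τ = 1 := by
      interval_cases a'
      · have h2 : (n + 1) * (1 + d) ≤ (n + 1) * τ := Nat.mul_le_mul_left _ (by simpa using hτδ)
        have h3 : (n + 1) * (1 + d) = (n + 1) + n * d + d := by ring
        have h4 : (n + 1) * (n + 1) = n * n + n + n + 1 := by ring
        have hl : d = 0 → n * d = 0 := fun h => by simp [h]
        have hq : 2 ≤ τ → 2 * (n + 1) ≤ (n + 1) * τ := fun h => Nat.mul_le_mul_left _ h |> fun h' => by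
          simpa [mul_comm] using h'
        omega
      · exfalso
        have hdpos : 0 < d := by
          by_contra h0
          push Not at h0
          have : d = 0 := by omega
          exact hnot ⟨rfl, by omega⟩
        have h2 : (n + 1) * d ≤ (n + 1) * τ := Nat.mul_le_mul_left _ (by simpa using hτδ)
        have h3 : (n + 1) * d = n * d + d := by ring
        have h4 : (n + 1) * (n + 1) = n * n + n + n + 1 := by ring
        omega
    obtain ⟨rfl, rfl, rfl, rfl⟩ := hspecial
    have hb' : b' = n + 1 := by omega
    subst hb'
    -- `T D₁^N ≤ K D₀ D₁^N`
    have hpos : 0 < D₁ ^ (n + 1) := pow_pos (lt_of_lt_of_le (by positivity) hD₁) _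
    have h6 : T * D₁ ^ (n + 1) ≤ (K * D₀) * D₁ ^ (n + 1) := by simpa using hineq
    have h7 : T ≤ K * D₀ := Nat.le_of_mul_le_mul_right h6 hpos
    omega
  · -- the structural inequality is `eL ≤ N²` rewritten
    interval_cases a'
    · have h4 : (n + 1) * (1 + d) = (n + 1) + n * d + d := by ring
      have h5 : (n + 1) * (n + 1) = n * n + n + n + 1 := by ring
      simp only [Nat.sub_zero, mul_zero, add_zero] at heL_le ⊢
      omega
    · have h4 : (n + 1) * (0 + d) = n * d + d := by ring
      have h5 : (n + 1) * (n + 1) = n * n + n + n + 1 := by ring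
      simp only [Nat.sub_self, mul_one] at heL_le ⊢
      omega

/-! ### Subgroups: the dimension of the additive part -/

/-- `dim V' ≤ 1`. [folklore] -/
theorem addDim_le_one {N : ℕ} (H : ConnAlgSubgroup N) : H.addDim ≤ 1 := by
  unfold ConnAlgSubgroup.addDim; split_ifs <;> omega

/-- `dim V' = 1 ↔ V' = 𝔾ₐ`. [folklore] -/
theorem addDim_eq_one_iff {N : ℕ} (H : ConnAlgSubgroup N) : H.addDim = 1 ↔ H.addPart = true := by
  unfold ConnAlgSubgroup.addDim; split_ifs with h <;> simp [h]

/-! ### The endgame -/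

/-- **Waldschmidt's linear subgroup theorem on `𝔾ₐ × 𝔾ₘ^N`, from the auxiliary polynomials**
([Waldschmidt1988, Thm 4.1] for `G = 𝔾ₐ × 𝔾ₘ^N`, `d₂ = 0`, `n = d - 1`, `κ` dropped). Let
`y_k = (θ_k, (z_{hk})_h) ∈ Lie G` (`k < ℓ`), `W ≠ 0` a subspace, and suppose that for all large
`S` there is a non-zero `P` with `deg_X P ≤ S^N L`, `deg_{Y_j} P ≤ C₁ S^{N-1} L⁴` vanishing to order
`≥ (N+1) S^N L² + 1` along `exp_G(W)` at all `σ(μ) = exp_G(∑ μ_k y_k)`, `0 ≤ μ_k ≤ (N+1)S`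
(`L = L(S) ≥ 1`, `L → ∞`, `L^{4N+2} ≤ S` eventually). Then there is a connected algebraic subgroup
`G' = V' × T_M ≠ G` and `r` independent integer relations `ρᵢ` with `σ(ρᵢ) ∈ G'` such that, with
`τ = dim W − dim(W ∩ Lie G')`, `δ = (1 − dim V') + (N − dim T_M)`, `δ₁ = N − dim T_M`, `λ = ℓ − r`:
`τ < δ` and `λ + δ₁ + Nτ ≤ Nδ`. [cite: Waldschmidt1988, §4 Thm 4.1, §7] -/
theorem linearSubgroup_of_vanishing {N l : ℕ} (hN : 1 ≤ N) (θ : Fin l → ℂ) (z : Fin N → Fin l → ℂ)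
    (W : Submodule ℂ (ℂ × (Fin N → ℂ))) (hW : 0 < finrank ℂ W)
    (L : ℕ → ℕ) (hL1 : ∀ S, 1 ≤ L S) (hLtop : Tendsto L atTop atTop)
    (hLS : ∀ᶠ S in atTop, L S ^ (4 * N + 2) ≤ S) {C₁ : ℕ} (hC₁ : 1 ≤ C₁)
    (hP : ∀ᶠ S in atTop, ∃ P : MvPolynomial (Fin (N + 1)) ℂ, P ≠ 0 ∧
        P.degreeOf 0 ≤ S ^ N * L S ∧ (∀ j : Fin N, P.degreeOf j.succ ≤ C₁ * S ^ (N - 1) * L S ^ 4) ∧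
        ∀ μ : Fin l → ℕ, (∀ k, μ k ≤ (N + 1) * S) →
          VanishesToOrder P W (sig θ z fun k => (μ k : ℤ)) ((N + 1) * (S ^ N * L S ^ 2) + 1)) :
    ∃ H : ConnAlgSubgroup N, ¬ (H.addPart = true ∧ H.chars = ⊥) ∧
      ∃ (r : ℕ) (ρ : Fin r → Fin l → ℤ), LinearIndependent ℤ ρ ∧ (∀ i, sig θ z (ρ i) ∈ H.toSubgroup) ∧
        finrank ℂ W - finrank ℂ ↥(W ⊓ H.tangent) < (1 - H.addDim) + (N - H.torusDim) ∧
        (l - r) + (N - H.torusDim) + N * (finrank ℂ W - finrank ℂ ↥(W ⊓ H.tangent)) ≤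
          N * ((1 - H.addDim) + (N - H.torusDim)) := by
  classical
  obtain ⟨n, rfl⟩ : ∃ n, N = n + 1 := ⟨N - 1, by omega⟩
  obtain ⟨c, hc⟩ := Philippon1986_GaGm_holds (n + 1)
  set t := finrank ℂ W with ht
  set K := t.factorial * c with hK
  -- Step 0: a good `S`
  have hLbig : ∀ᶠ S in atTop, K * C₁ ^ (n + 1) * (n + 1) ^ (n + 1) < L S :=
    hLtop.eventually (eventually_gt_atTop _)
  obtain ⟨S, ⟨P, hP0, hdeg0, hdeg1, hvan⟩, hLS', hLbig', hS1⟩ :=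
    (hP.and (hLS.and (hLbig.and (eventually_ge_atTop 1)))).exists
  simp only [Nat.add_sub_cancel] at hdeg1
  set Lv := L S with hLv
  have hLv1 : 1 ≤ Lv := hL1 S
  set D₀ := S ^ (n + 1) * Lv with hD₀
  set T := S ^ (n + 1) * Lv ^ 2 with hT
  set D₁ := C₁ * S ^ n * Lv ^ 4 with hD₁
  have hSpos : 0 < S := hS1
  have hD₀1 : 1 ≤ D₀ := Nat.mul_le_mul (Nat.one_le_pow _ _ hSpos) hLv1
  have hD₁1 : 1 ≤ D₁ := Nat.mul_le_mul (Nat.mul_le_mul hC₁ (Nat.one_le_pow _ _ hSpos)) (Nat.one_le_pow _ _ hLv1)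
  have hND₁ : 1 ≤ (n + 1) * D₁ := Nat.mul_le_mul (Nat.succ_pos n) hD₁1
  -- Step 1: the box `[0, S]^ℓ` and the points `σ(μ)`
  set box : Finset (Fin l → ℕ) := Fintype.piFinset fun _ : Fin l => Finset.range (S + 1) with hbox
  have hmem_box : ∀ μ : Fin l → ℕ, μ ∈ box ↔ ∀ k, μ k ≤ S := fun μ => by
    simp only [hbox, Fintype.mem_piFinset, Finset.mem_range, Nat.lt_succ_iff]
  let toZ : (Fin l → ℕ) → Fin l → ℤ := fun μ k => (μ k : ℤ)
  let pt : (Fin l → ℕ) → GaGm (n + 1) := fun μ => sig θ z (toZ μ)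
  set Sset : Set (GaGm (n + 1)) := ↑(box.image pt) with hSset
  have hSfin : Sset.Finite := Finset.finite_toSet _
  have h0box : (0 : Fin l → ℕ) ∈ box := (hmem_box 0).mpr fun k => Nat.zero_le _
  have h1S : (1 : GaGm (n + 1)) ∈ Sset := by
    rw [hSset, Finset.coe_image]
    refine ⟨0, by exact_mod_cast h0box, ?_⟩
    show sig θ z (toZ 0) = 1
    have : toZ 0 = 0 := by funext k; simp [toZ]
    rw [this, sig_zero]
  -- Step 2: vanishing on `Σ(N+1)`
  have hvanS : ∀ g ∈ sumset Sset (n + 1 + 1), VanishesToOrder P W g ((n + 1 + 1) * T + 1) := by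
    rintro g ⟨σ', hσ', rfl⟩
    have hex : ∀ i, ∃ μ ∈ box, pt μ = σ' i := fun i => by
      have := hσ' i
      rw [hSset, Finset.coe_image] at this
      obtain ⟨μ, hμ, e⟩ := this
      exact ⟨μ, by exact_mod_cast hμ, e⟩
    choose μ hμbox hμeq using hex
    set Mv : Fin l → ℕ := fun k => ∑ i, μ i k with hMv
    have hMvle : ∀ k, Mv k ≤ (n + 1 + 1) * S := fun k => by
      rw [hMv]
      calc ∑ i, μ i k ≤ ∑ _i : Fin (n + 1 + 1), S :=
            Finset.sum_le_sum fun i _ => (hmem_box _).mp (hμbox i) k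
        _ = (n + 1 + 1) * S := by simp
    have hprod : ∏ i, σ' i = sig θ z (toZ Mv) := by
      have e1 : toZ Mv = ∑ i, toZ (μ i) := by
        funext k; simp [toZ, hMv]
      rw [e1, sig_sum]
      exact Finset.prod_congr rfl fun i _ => (hμeq i).symm
    rw [hprod]
    exact hvan Mv hMvle
  -- Step 3: degrees and the zero estimate
  have hdegtot : ∀ s ∈ P.support, ∑ j : Fin (n + 1), s (Fin.succ j) ≤ (n + 1) * D₁ := by
    intro s hs
    calc ∑ j : Fin (n + 1), s (Fin.succ j) ≤ ∑ _j : Fin (n + 1), D₁ :=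
          Finset.sum_le_sum fun j _ => (MvPolynomial.monomial_le_degreeOf j.succ hs).trans (hdeg1 j)
      _ = (n + 1) * D₁ := by simp
  obtain ⟨H, ⟨g, hg⟩, hineq⟩ :=
    hc D₀ ((n + 1) * D₁) T W Sset P hD₀1 hND₁ hW hSfin h1S hP0 hdeg0 hdegtot hvanS
  -- Step 4: `G' ≠ G`
  have hnot : ¬ (H.addPart = true ∧ H.chars = ⊥) := by
    rintro ⟨hadd, hchars⟩
    refine hP0 (DiazZLM.eq_zero_of_evalAt_translate P hdeg1 H hadd ?_ g hg)
    intro χ hχ hne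
    rw [hchars, AddSubgroup.mem_bot] at hχ
    exact absurd hχ hne
  have hnot' : ¬ (H.addDim = 1 ∧ H.torusDim = n + 1) := fun ⟨h1, h2⟩ =>
    hnot ⟨(addDim_eq_one_iff H).mp h1, chars_eq_bot_of_torusDim_eq H h2⟩
  -- Step 5: the relations `B = {ν ; σ(ν) ∈ G'}` and the coordinates complementary to them
  let φ : (Fin l → ℤ) →+ Additive (GaGm (n + 1)) :=
    { toFun := fun ν => Additive.ofMul (sig θ z ν)
      map_zero' := by simp
      map_add' := fun ν ν' => by simp [sig_add] }
  let B : Submodule ℤ (Fin l → ℤ) :=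
    AddSubgroup.toIntSubmodule ((Subgroup.toAddSubgroup H.toSubgroup).comap φ)
  have hmemB : ∀ ν, ν ∈ B ↔ sig θ z ν ∈ H.toSubgroup := fun ν => Iff.rfl
  obtain ⟨κ, _, a, ha, hcardκ, hsep⟩ := Waldschmidt1981.exists_coord_complement l B
  -- Step 6: counting classes: the sub-box in the directions `a` injects into `(Σ·G')/G'`
  let ext : (κ → Fin (S + 1)) → (Fin l → ℕ) := fun m => Function.extend a (fun k => (m k : ℕ)) 0
  have hext_apply : ∀ m k, ext m (a k) = (m k : ℕ) := fun m k => ha.extend_apply _ _ _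
  have hext_off : ∀ m j, (¬ ∃ k, a k = j) → ext m j = 0 := fun m j hj => by
    simp only [ext]
    rw [Function.extend_apply' _ _ _ hj]
    rfl
  have hextBox : ∀ m, ext m ∈ box := by
    intro m
    rw [hmem_box]
    intro j
    by_cases hj : ∃ k, a k = j
    · obtain ⟨k, rfl⟩ := hj
      rw [hext_apply]
      exact Nat.lt_succ_iff.mp (m k).isLt
    · rw [hext_off m j hj]
      exact Nat.zero_le _
  let Φ : (κ → Fin (S + 1)) → GaGm (n + 1) ⧸ H.toSubgroup := fun m => QuotientGroup.mk (pt (ext m))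
  have hΦS : Set.range Φ ⊆ (QuotientGroup.mk : GaGm (n + 1) → GaGm (n + 1) ⧸ H.toSubgroup) '' Sset := by
    rintro _ ⟨m, rfl⟩
    refine ⟨pt (ext m), ?_, rfl⟩
    rw [hSset, Finset.coe_image]
    exact ⟨ext m, by exact_mod_cast hextBox m, rfl⟩
  have hΦinj : Function.Injective Φ := by
    intro m₁ m₂ h
    have hmem : (pt (ext m₁))⁻¹ * pt (ext m₂) ∈ H.toSubgroup := QuotientGroup.eq.mp h
    simp only [pt] at hmem
    rw [sig_inv_mul] at hmem
    have hcB : toZ (ext m₂) - toZ (ext m₁) ∈ B := (hmemB _).mpr hmem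
    have hcsupp : ∀ j, (¬ ∃ k, a k = j) → (toZ (ext m₂) - toZ (ext m₁)) j = 0 := fun j hj => by
      simp only [toZ, Pi.sub_apply, hext_off _ j hj, Nat.cast_zero, sub_zero]
    have hc0 := hsep _ hcB hcsupp
    funext k
    have hk := hc0 k
    simp only [toZ, Pi.sub_apply, hext_apply] at hk
    exact Fin.ext (by omega)
  have hcount : (S + 1) ^ Fintype.card κ ≤
      ((QuotientGroup.mk : GaGm (n + 1) → GaGm (n + 1) ⧸ H.toSubgroup) '' Sset).ncard := by
    calc (S + 1) ^ Fintype.card κ = Nat.card (κ → Fin (S + 1)) := by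
          rw [Nat.card_eq_fintype_card, Fintype.card_fun, Fintype.card_fin]
      _ = (Set.range Φ).ncard := (Set.ncard_range_of_injective hΦinj).symm
      _ ≤ ((QuotientGroup.mk : GaGm (n + 1) → GaGm (n + 1) ⧸ H.toSubgroup) '' Sset).ncard :=
          Set.ncard_le_ncard hΦS (hSfin.image _)
  -- Step 7: the numeric inequality `T^τ (S+1)^λ D₀^{a'} (ND₁)^{b'} ≤ K D₀ (ND₁)^N`
  set s := finrank ℂ W - finrank ℂ ↥(W ⊓ H.tangent) with hs
  have hst : s ≤ t := Nat.sub_le _ _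
  have hmain : T ^ s * (S + 1) ^ Fintype.card κ * D₀ ^ H.addDim * ((n + 1) * D₁) ^ H.torusDim ≤
      K * D₀ * ((n + 1) * D₁) ^ (n + 1) := by
    have h1 : T ^ s * (S + 1) ^ Fintype.card κ ≤
        t.factorial * (Nat.choose (T + s) s *
          ((QuotientGroup.mk : GaGm (n + 1) → GaGm (n + 1) ⧸ H.toSubgroup) '' Sset).ncard) := by
      calc T ^ s * (S + 1) ^ Fintype.card κ
          ≤ (s.factorial * Nat.choose (T + s) s) *
              ((QuotientGroup.mk : GaGm (n + 1) → GaGm (n + 1) ⧸ H.toSubgroup) '' Sset).ncard :=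
            Nat.mul_le_mul (pow_le_factorial_mul_choose T s) hcount
        _ ≤ (t.factorial * Nat.choose (T + s) s) *
              ((QuotientGroup.mk : GaGm (n + 1) → GaGm (n + 1) ⧸ H.toSubgroup) '' Sset).ncard :=
            Nat.mul_le_mul_right _ (Nat.mul_le_mul_right _ (Nat.factorial_le hst))
        _ = _ := by ring
    calc T ^ s * (S + 1) ^ Fintype.card κ * D₀ ^ H.addDim * ((n + 1) * D₁) ^ H.torusDim
        ≤ t.factorial * (Nat.choose (T + s) s *
            ((QuotientGroup.mk : GaGm (n + 1) → GaGm (n + 1) ⧸ H.toSubgroup) '' Sset).ncard) *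
            D₀ ^ H.addDim * ((n + 1) * D₁) ^ H.torusDim := by gcongr
      _ = t.factorial * (Nat.choose (T + s) s *
            ((QuotientGroup.mk : GaGm (n + 1) → GaGm (n + 1) ⧸ H.toSubgroup) '' Sset).ncard *
            D₀ ^ H.addDim * ((n + 1) * D₁) ^ H.torusDim) := by ring
      _ ≤ t.factorial * (c * D₀ * ((n + 1) * D₁) ^ (n + 1)) := Nat.mul_le_mul_left _ hineq
      _ = K * D₀ * ((n + 1) * D₁) ^ (n + 1) := by rw [hK]; ring
  -- Step 8: the parameters dominate
  set A := (n + 1) * C₁ * Lv ^ 4 with hA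
  set M := (n + 1) ^ (n + 1) with hM
  set Cp := C₁ ^ (n + 1) with hCp
  clear_value A M Cp
  have hAM : A ^ (n + 1) = M * Cp * Lv ^ (4 * (n + 1)) := by
    rw [hA, mul_pow, mul_pow, ← pow_mul, hM, hCp]
  have hND₁eq : (n + 1) * D₁ = A * S ^ n := by rw [hD₁, hA]; ring
  have hsmall : K * Lv * A ^ (n + 1) < S := by
    calc K * Lv * A ^ (n + 1) = (K * Cp * M) * (Lv * Lv ^ (4 * (n + 1))) := by rw [hAM]; ring
      _ < Lv * (Lv * Lv ^ (4 * (n + 1))) := Nat.mul_lt_mul_of_pos_right hLbig' (by positivity)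
      _ = Lv ^ (4 * (n + 1) + 2) := by ring
      _ ≤ S := hLS'
  have hR : K * D₀ * ((n + 1) * D₁) ^ (n + 1) < S ^ ((n + 1) * (n + 1) + 1) := by
    have e1 : K * D₀ * ((n + 1) * D₁) ^ (n + 1) =
        (K * Lv * A ^ (n + 1)) * (S ^ (n + 1) * (S ^ n) ^ (n + 1)) := by
      rw [hND₁eq, hD₀, mul_pow]; ring
    have e2 : S ^ (n + 1) * (S ^ n) ^ (n + 1) = S ^ ((n + 1) * (n + 1)) := by
      rw [← pow_mul, ← pow_add]; congr 1; ring
    rw [e1, e2, pow_succ S ((n + 1) * (n + 1)), mul_comm (S ^ ((n + 1) * (n + 1))) S]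
    exact Nat.mul_lt_mul_of_pos_right hsmall (by positivity)
  have hKLv : K < Lv := by
    calc K ≤ K * Cp * M := by
          calc K = K * 1 * 1 := by ring
            _ ≤ K * Cp * M := by
                gcongr
                · rw [hCp]; exact Nat.one_le_pow _ _ hC₁
                · rw [hM]; exact Nat.one_le_pow _ _ (Nat.succ_pos n)
      _ < Lv := hLbig'
  have hTD : K * D₀ < T := by
    rw [hD₀, hT, show S ^ (n + 1) * Lv ^ 2 = Lv * (S ^ (n + 1) * Lv) by ring]
    exact Nat.mul_lt_mul_of_pos_right hKLv (by positivity)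
  have hTge : S ^ (n + 1) ≤ T := Nat.le_mul_of_pos_right _ (by positivity)
  have hD₀ge : S ^ (n + 1) ≤ D₀ := Nat.le_mul_of_pos_right _ (by positivity)
  have hD₁ge : S ^ n ≤ (n + 1) * D₁ := by
    rw [hND₁eq, mul_comm]
    refine Nat.le_mul_of_pos_right _ ?_
    rw [hA]; positivity
  obtain ⟨hτδ, hstruct⟩ := numeric_exclusion hS1 hTge hD₀ge hD₁ge hR hTD (addDim_le_one H)
    (torusDim_le H) hnot' hmain
  -- Step 9: a basis of the relations
  obtain ⟨r, bB⟩ := Submodule.basisOfPid (Pi.basisFun ℤ (Fin l)) B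
  have hr : finrank ℤ B = r := by rw [finrank_eq_card_basis bB, Fintype.card_fin]
  refine ⟨H, hnot, r, fun i => (bB i : Fin l → ℤ), ?_, fun i => (hmemB _).mp (bB i).2, hτδ, ?_⟩
  · exact bB.linearIndependent.map' B.subtype (Submodule.ker_subtype B)
  · have h1 : l - r ≤ Fintype.card κ := by rw [← hr]; omega
    calc l - r + (n + 1 - H.torusDim) + (n + 1) * s
        ≤ Fintype.card κ + (n + 1 - H.torusDim) + (n + 1) * s := by omega
      _ ≤ (n + 1) * ((1 - H.addDim) + (n + 1 - H.torusDim)) := hstruct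

end Literature.NumberTheory.Transcendental.LinearSubgroupGaGm

end
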